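import Mathlib
import Literature.NumberTheory.Sieve.LargeGapsBetweenPrimes
import Literature.NumberTheory.Sieve.LargeGapsWestzynthiusProofs
import Literature.NumberTheory.Sieve.RankinSmoothBound
import Literature.NumberTheory.LFunctions.MertensFormula
import Literature.NumberTheory.LFunctions.RHWave0PNTProofs
import HarnessLib

/-!
# Erdős's large-gap theorem `G(X) ≫ log X · log₂ X / (log₃ X)²` — PROVED (Erdős–Rankin method)

Topic `Literature/NumberTheory/Sieve`. PROOF FILE (theorems only): we discharge the named fact
`Literature.NumberTheory.Sieve.Erdos1935_largeGaps` of `LargeGapsBetweenPrimes.lean`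
(`erdos1935_largeGaps_holds`) by running Montgomery–Vaughan's proof of Lemma 7.13 / Theorem 7.15
with the parameter `L` depending on `z`, `L = ⌊log z/(log log z)²⌋` (Erdős's choice; Rankin's
sharper `L = log z · log₃ z/(4 (log₂ z)²)`, which gives the extra factor `log₄`, needs the constants
of the smooth-number bound and of Mertens' theorem tuned against each other and is not attempted).

Inputs, all proved in the tree: the deterministic three-sieving criterion
(`residueClassesCover_of_count`, assembled from `Westzynthius.greedy_sieve`,
`Westzynthius.mem_smoothNumbers_or_prime` and `residueClassesCover_of_injOn`); Mertens' product
theorem in relative-error form (`LFunctions.Mertens.abs_prod_one_sub_inv_mul_log_sub_one_le`,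
giving `∏_{K<p≤M} (1 − 1/p) ≤ 3 log K / log M`); Rankin's bound with an explicit Euler product
(`card_smoothNumbersUpTo_le_rankin_exp`, used with `η = 6 log₂ z / log z`); the prime number
theorem (`LFunctions.primeCounting_isEquivalent_holds`); and the transfer to gaps
(`hasPrimeGap_of_cover`, `primorial_le_four_pow`).

References: Montgomery–Vaughan, *Multiplicative Number Theory I*, §7.3, Lemma 7.13, Theorem 7.15
and the Notes to §7.3, pp. 221–223, 234 [MontgomeryVaughan2007]; P. Erdős, *On the difference of
consecutive primes*, Quart. J. Math. Oxford 6 (1935) 124–128 [Erdos1935]; R. A. Rankin, *The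
difference between consecutive prime numbers*, J. London Math. Soc. 13 (1938) 242–247 [Rankin1938].
-/

noncomputable section

open Filter Finset

namespace Literature.NumberTheory.Sieve

namespace ErdosRankin

/-! ### The deterministic criterion -/

/-- An injection from a finite set into any finite set at least as large. [folklore] -/
private theorem exists_injOn_of_card_le {S T : Finset ℕ} (h : S.card ≤ T.card) :
    ∃ q : ℕ → ℕ, Set.InjOn q S ∧ ∀ s ∈ S, q s ∈ T := by
  classical
  obtain ⟨T', hT'T, hcardT'⟩ := le_card_iff_exists_subset_card.1 h
  let e : S ≃ T' := equivOfCardEq hcardT'.symm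
  refine ⟨fun s => if hs : s ∈ S then ((e ⟨s, hs⟩ : T') : ℕ) else 0, ?_, ?_⟩
  · intro s₁ hs₁ s₂ hs₂ heq
    have hs₁' : s₁ ∈ S := by simpa using hs₁
    have hs₂' : s₂ ∈ S := by simpa using hs₂
    simp only [hs₁', hs₂', dif_pos] at heq
    have := e.injective (Subtype.ext heq)
    simpa using this
  · intro s hs
    simp only [hs, dif_pos]
    exact hT'T (e ⟨s, hs⟩).2

/-- `π(n) = #(primes < n + 1)`. [folklore] -/
private theorem primeCounting_eq_card_primesBelow (n : ℕ) :
    Nat.primeCounting n = ((n + 1).primesBelow).card := by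
  rw [Nat.primesBelow_card_eq_primeCounting']; rfl

/-- **The Erdős–Rankin covering criterion** (MV pp. 221–222, the three sievings made
deterministic): let `K ≤ M ≤ z/2` and `N < (z/2 + 1)(K + 1)`. Sieve `[1, N]` by `0 (mod p)` for
`p ≤ K` and for `M < p ≤ z/2` (survivors: `(M+1)`-smooth numbers and primes, at most
`Ψ(N, M+1) + π(N)` of them), then greedily for `K < p ≤ M` (keeping a fraction `∏ (1 − 1/p)`, plus
at most `M` exceptions), and match the rest injectively with the `π(z) − π(z/2)` primes in
`(z/2, z]`. If `(Ψ(N, M+1) + π(N)) ∏_{K<p≤M} (1 − 1/p) + M ≤ π(z) − π(z/2)`, then `Y(z) ≥ N`.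
[cite: MontgomeryVaughan2007, Lemma 7.13 (proof)] -/
theorem residueClassesCover_of_count {z N K M : ℕ} (hKM : K ≤ M) (hMQ : M ≤ z / 2)
    (hNQK : N < (z / 2 + 1) * (K + 1))
    (hcount : (((N.smoothNumbersUpTo (M + 1)).card : ℝ) + Nat.primeCounting N) *
        (∏ p ∈ (Ioc K M).filter Nat.Prime, (1 - 1 / (p : ℝ))) + M
        ≤ (Nat.primeCounting z : ℝ) - Nat.primeCounting (z / 2)) :
    ResidueClassesCover z N := by
  classical
  set Q := z / 2 with hQ
  have hQz : Q ≤ z := Nat.div_le_self _ _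
  have hKQ : K ≤ Q := le_trans hKM hMQ
  set P₂ : Finset ℕ := (Ioc K M).filter Nat.Prime with hP₂
  have hP₂pos : ∀ p ∈ P₂, 0 < p := fun p hp => (mem_filter.1 hp).2.pos
  set V₀ : Finset ℕ :=
    (Icc 1 N).filter (fun t => ∀ p, p.Prime → p ∣ t → (K < p ∧ p ≤ M) ∨ Q < p) with hV₀
  obtain ⟨a', ha', hcard'⟩ := Westzynthius.greedy_sieve P₂ hP₂pos V₀
  set V₁ : Finset ℕ := V₀.filter (fun t => ∀ p ∈ P₂, t % p ≠ a' p) with hV₁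
  set P₄ : Finset ℕ := (Ioc Q z).filter Nat.Prime with hP₄
  -- `#V₀ ≤ Ψ(N, M+1) + π(N)`
  have hV₀sub : V₀ ⊆ N.smoothNumbersUpTo (M + 1) ∪ (N + 1).primesBelow := by
    intro t ht
    obtain ⟨htI, hcop⟩ := mem_filter.1 ht
    obtain ⟨ht1, htN⟩ := mem_Icc.1 htI
    rcases Westzynthius.mem_smoothNumbers_or_prime ht1 htN hNQK hKQ hcop with hsm | ⟨htp, -⟩
    · exact mem_union_left _ (Nat.mem_smoothNumbersUpTo.2 ⟨htN, hsm⟩)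
    · exact mem_union_right _ (Nat.mem_primesBelow.2 ⟨by omega, htp⟩)
  have hV₀card : (V₀.card : ℝ) ≤ ((N.smoothNumbersUpTo (M + 1)).card : ℝ) + Nat.primeCounting N := by
    have h1 : V₀.card ≤ (N.smoothNumbersUpTo (M + 1)).card + ((N + 1).primesBelow).card :=
      (card_le_card hV₀sub).trans (card_union_le _ _)
    rw [← primeCounting_eq_card_primesBelow] at h1
    exact_mod_cast h1
  have hP₂card : (P₂.card : ℝ) ≤ M := by
    have : P₂.card ≤ M := (card_filter_le _ _).trans (by simp)
    exact_mod_cast this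
  have hP₄card : (Nat.primeCounting z : ℝ) ≤ Nat.primeCounting Q + P₄.card := by
    have hsub : (z + 1).primesBelow ⊆ (Q + 1).primesBelow ∪ P₄ := by
      intro p hp
      obtain ⟨hpz, hpp⟩ := Nat.mem_primesBelow.1 hp
      by_cases hpQ : p ≤ Q
      · exact mem_union_left _ (Nat.mem_primesBelow.2 ⟨by omega, hpp⟩)
      · exact mem_union_right _ (mem_filter.2 ⟨mem_Ioc.2 ⟨by omega, by omega⟩, hpp⟩)
    have := (card_le_card hsub).trans (card_union_le _ _)
    rw [← primeCounting_eq_card_primesBelow, ← primeCounting_eq_card_primesBelow] at this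
    exact_mod_cast this
  have hprod0 : 0 ≤ ∏ p ∈ P₂, (1 - 1 / (p : ℝ)) := by
    refine Finset.prod_nonneg fun q hq => ?_
    have hq1 : (1 : ℝ) ≤ q := by exact_mod_cast hP₂pos q hq
    rw [sub_nonneg, div_le_one (by linarith)]; exact hq1
  have hV₁card : V₁.card ≤ P₄.card := by
    have : (V₁.card : ℝ) ≤ P₄.card :=
      calc (V₁.card : ℝ) ≤ (V₀.card : ℝ) * (∏ p ∈ P₂, (1 - 1 / (p : ℝ))) + P₂.card := hcard'
        _ ≤ (((N.smoothNumbersUpTo (M + 1)).card : ℝ) + Nat.primeCounting N) *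
              (∏ p ∈ P₂, (1 - 1 / (p : ℝ))) + M := by gcongr
        _ ≤ (Nat.primeCounting z : ℝ) - Nat.primeCounting Q := hcount
        _ ≤ P₄.card := by linarith
    exact_mod_cast this
  -- the cover
  obtain ⟨q, hinj, hq⟩ := exists_injOn_of_card_le hV₁card
  let a : ℕ → ℕ := fun p => if K < p ∧ p ≤ M then a' p else 0
  refine residueClassesCover_of_injOn hQz a V₁ ?_ q hinj ?_
  · intro t ht1 htN htV₁
    by_cases htV₀ : t ∈ V₀
    · have h : ¬ ∀ p ∈ P₂, t % p ≠ a' p := fun h => htV₁ (mem_filter.2 ⟨htV₀, h⟩)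
      simp only [not_forall, not_not] at h
      obtain ⟨p, hpP₂, htp⟩ := h
      obtain ⟨hpI, hpp⟩ := mem_filter.1 hpP₂
      obtain ⟨hKp, hpM⟩ := mem_Ioc.1 hpI
      refine ⟨p, hpp, by omega, ?_⟩
      have hap : a p = a' p := by simp [a, hKp, hpM]
      show t % p = a p % p
      rw [hap, Nat.mod_eq_of_lt (ha' p hpP₂), htp]
    · have h : ¬ ∀ p, p.Prime → p ∣ t → (K < p ∧ p ≤ M) ∨ Q < p := fun h =>
        htV₀ (mem_filter.2 ⟨mem_Icc.2 ⟨ht1, htN⟩, h⟩)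
      simp only [not_forall] at h
      obtain ⟨p, hpp, hpt, hno⟩ := h
      refine ⟨p, hpp, by omega, ?_⟩
      have hap : a p = 0 := by
        simp only [a]
        split_ifs with hh
        · exact absurd (Or.inl hh) hno
        · rfl
      rw [hap]
      exact Nat.modEq_zero_iff_dvd.2 hpt
  · intro t ht
    obtain ⟨hI, hp⟩ := mem_filter.1 (hq t ht)
    obtain ⟨hQt, htz⟩ := mem_Ioc.1 hI
    exact ⟨hp, hQt, htz⟩

/-! ### Mertens: `∏_{K < p ≤ M} (1 − 1/p) ≤ 3 log K / log M` -/

/-- The Mertens product is positive. [folklore] -/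
private theorem prod_primesLE_pos (n : ℕ) : 0 < ∏ p ∈ Nat.primesLE n, (1 - (p : ℝ)⁻¹) := by
  refine Finset.prod_pos fun p hp => ?_
  have hp2 : (2 : ℝ) ≤ p := by exact_mod_cast (Nat.prime_of_mem_primesLE hp).two_le
  have : (p : ℝ)⁻¹ ≤ 1 / 2 := by rw [inv_eq_one_div]; exact one_div_le_one_div_of_le (by norm_num) hp2
  linarith

/-- **Mertens' product theorem, ratio form**: for `log K ≥ 48` and `K ≤ M`,
`∏_{K<p≤M} (1 − 1/p) ≤ 3 log K / log M` (from `∏_{p≤x}(1 − 1/p) = (1 + O(1/log x))/(e^γ log x)`,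
the tree's `Mertens.abs_prod_one_sub_inv_mul_log_sub_one_le`; MV: "By Mertens' theorem the product
… is `∼ 1/L`"). [cite: MontgomeryVaughan2007, Theorem 2.7(e); Lemma 7.13 (proof)] -/
theorem prod_one_sub_inv_Ioc_le {K M : ℕ} (hK2 : 2 ≤ K) (hK : (48 : ℝ) ≤ Real.log K)
    (hKM : K ≤ M) :
    ∏ p ∈ (Ioc K M).filter Nat.Prime, (1 - 1 / (p : ℝ)) ≤ 3 * Real.log K / Real.log M := by
  have hKr : (2 : ℝ) ≤ K := by exact_mod_cast hK2
  have hMr : (2 : ℝ) ≤ M := by exact_mod_cast (hK2.trans hKM)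
  have hlogKM : Real.log K ≤ Real.log M := Real.log_le_log (by linarith) (by exact_mod_cast hKM)
  have hM48 : (48 : ℝ) ≤ Real.log M := hK.trans hlogKM
  have hγ : 0 < Real.exp Real.eulerMascheroniConstant := Real.exp_pos _
  have hMK := Literature.NumberTheory.LFunctions.Mertens.abs_prod_one_sub_inv_mul_log_sub_one_le
    (x := (K : ℝ)) hKr (by linarith)
  have hMM := Literature.NumberTheory.LFunctions.Mertens.abs_prod_one_sub_inv_mul_log_sub_one_le
    (x := (M : ℝ)) hMr (by linarith)
  rw [Nat.floor_natCast] at hMK hMM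
  have hApos : 0 < ∏ p ∈ Nat.primesLE K, (1 - (p : ℝ)⁻¹) := prod_primesLE_pos K
  -- split the product over `primesLE M`
  have hsplit : Nat.primesLE M = Nat.primesLE K ∪ (Ioc K M).filter Nat.Prime := by
    ext p
    simp only [Nat.mem_primesLE, mem_union, mem_filter, mem_Ioc]
    constructor
    · rintro ⟨hpM, hp⟩
      by_cases h : p ≤ K
      · exact Or.inl ⟨h, hp⟩
      · exact Or.inr ⟨⟨by omega, hpM⟩, hp⟩
    · rintro (⟨hpK, hp⟩ | ⟨⟨-, hpM⟩, hp⟩)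
      · exact ⟨hpK.trans hKM, hp⟩
      · exact ⟨hpM, hp⟩
  have hdisj : Disjoint (Nat.primesLE K) ((Ioc K M).filter Nat.Prime) := by
    rw [Finset.disjoint_left]
    intro p hp hp'
    simp only [Nat.mem_primesLE, mem_filter, mem_Ioc] at hp hp'
    omega
  have hBeq : ∏ p ∈ Nat.primesLE M, (1 - (p : ℝ)⁻¹) =
      (∏ p ∈ Nat.primesLE K, (1 - (p : ℝ)⁻¹)) *
        ∏ p ∈ (Ioc K M).filter Nat.Prime, (1 - 1 / (p : ℝ)) := by
    rw [hsplit, Finset.prod_union hdisj]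
    congr 1
    exact Finset.prod_congr rfl fun p _ => by rw [one_div]
  set A := ∏ p ∈ Nat.primesLE K, (1 - (p : ℝ)⁻¹) with hA
  set P := ∏ p ∈ (Ioc K M).filter Nat.Prime, (1 - 1 / (p : ℝ)) with hP
  rw [hBeq] at hMM
  have hlogK : 0 < Real.log K := by linarith
  have hlogM : 0 < Real.log M := by linarith
  have h24K : 24 / Real.log K ≤ 1 / 2 := by rw [div_le_iff₀ hlogK]; linarith
  have h24M : 24 / Real.log M ≤ 1 / 2 := by rw [div_le_iff₀ hlogM]; linarith
  have hAK : 1 / 2 ≤ A * (Real.exp Real.eulerMascheroniConstant * Real.log K) := by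
    have := (abs_le.1 hMK).1; linarith
  have hBM : A * P * (Real.exp Real.eulerMascheroniConstant * Real.log M) ≤ 3 / 2 := by
    have := (abs_le.1 hMM).2; linarith
  have hP0 : 0 ≤ P := by
    refine Finset.prod_nonneg fun q hq => ?_
    have hq1 : (1 : ℝ) ≤ q := by exact_mod_cast (mem_filter.1 hq).2.one_le
    rw [sub_nonneg, div_le_one (by linarith)]; exact hq1
  rw [le_div_iff₀ hlogM]
  -- `γ' A (P log M) ≤ 3/2 ≤ 3 γ' A log K`, divide by `γ' A > 0`
  have hkey : Real.exp Real.eulerMascheroniConstant * A * (P * Real.log M) ≤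
      Real.exp Real.eulerMascheroniConstant * A * (3 * Real.log K) := by nlinarith
  exact le_of_mul_le_mul_left hkey (by positivity)

/-! ### Rankin's smooth-number bound, instantiated -/

/-- **`Ψ(N, M+1) ≤ e^{C} N/(log z)²`** from the tree's Rankin bound with `η = 6 log₂ z / log z`,
provided `z ≤ N`, `M + 1 ≤ z`, `η ≤ 1/2` and `η log(M+1) ≤ 289` (MV use Theorem 7.6 / Corollary 7.9
to get `Ψ(N, L^L) < N/(log N)²`; any bound saving two logarithms suffices).
[cite: MontgomeryVaughan2007, Theorem 7.15 (proof, (7.49))] -/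
theorem card_smooth_le {N M z : ℕ} {η : ℝ} (hz : 3 ≤ z) (hzN : z ≤ N) (hM1 : 1 ≤ M)
    (hMz : M + 1 ≤ z) (hη0 : 0 < η) (hη : η ≤ 1 / 2)
    (hηdef : η * Real.log z = 6 * Real.log (Real.log z))
    (hηM : η * Real.log (M + 1) ≤ 289) :
    ((N.smoothNumbersUpTo (M + 1)).card : ℝ) ≤
      N * Real.exp (16 + 1160 * Real.exp 289) / (Real.log z) ^ 2 := by
  have hk : 2 ≤ M + 1 := by omega
  have h := card_smoothNumbersUpTo_le_rankin_exp N hk hη0 hη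
  have hzr : (3 : ℝ) ≤ z := by exact_mod_cast hz
  have hNr : (3 : ℝ) ≤ N := by exact_mod_cast (hz.trans hzN)
  have hzN' : (z : ℝ) ≤ N := by exact_mod_cast hzN
  have hN0 : (0 : ℝ) < N := by linarith
  have hz0 : (0 : ℝ) < z := by linarith
  have hlogz : 1 < Real.log z := by
    rw [← Real.exp_lt_exp, Real.exp_log hz0]
    have := Real.exp_one_lt_d9; linarith
  have hlogz0 : 0 < Real.log z := by linarith
  have hMr : (2 : ℝ) ≤ (M : ℝ) + 1 := by exact_mod_cast (show 2 ≤ M + 1 by omega)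
  have hMz' : (M : ℝ) + 1 ≤ z := by exact_mod_cast hMz
  have hlogM0 : 0 < Real.log ((M : ℝ) + 1) := Real.log_pos (by linarith)
  -- `N^{1-η} ≤ N / (log z)^6`
  have h1 : (N : ℝ) ^ (1 - η) ≤ N / (Real.log z) ^ 6 := by
    rw [Real.rpow_sub hN0, Real.rpow_one]
    have hzη : (Real.log z) ^ 6 ≤ (N : ℝ) ^ η := by
      calc (Real.log z) ^ 6 = Real.exp (6 * Real.log (Real.log z)) := by
            rw [show (6 : ℝ) * Real.log (Real.log z) = ((6 : ℕ) : ℝ) * Real.log (Real.log z) by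
              norm_num, ← Real.log_pow, Real.exp_log (by positivity)]
        _ = Real.exp (η * Real.log z) := by rw [hηdef]
        _ = (z : ℝ) ^ η := by rw [Real.rpow_def_of_pos hz0, mul_comm]
        _ ≤ (N : ℝ) ^ η := Real.rpow_le_rpow hz0.le hzN' hη0.le
    exact div_le_div_of_nonneg_left hN0.le (by positivity) hzη
  -- the Euler-product exponent
  have h2 : Real.log (Real.log ((M : ℝ) + 1)) ≤ Real.log (Real.log z) :=
    Real.log_le_log hlogM0 (Real.log_le_log (by linarith) hMz')
  have h3 : ((M : ℝ) + 1) ^ η ≤ Real.exp 289 := by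
    rw [Real.rpow_def_of_pos (by linarith), Real.exp_le_exp, mul_comm]; exact hηM
  have h4 : η * ((M : ℝ) + 1) ^ η * (Real.log ((M : ℝ) + 1) + 2) ≤ 290 * Real.exp 289 := by
    have hpow0 : 0 ≤ ((M : ℝ) + 1) ^ η := Real.rpow_nonneg (by linarith) η
    have : η * (Real.log ((M : ℝ) + 1) + 2) ≤ 290 := by nlinarith
    calc η * ((M : ℝ) + 1) ^ η * (Real.log ((M : ℝ) + 1) + 2)
        = ((M : ℝ) + 1) ^ η * (η * (Real.log ((M : ℝ) + 1) + 2)) := by ring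
      _ ≤ Real.exp 289 * 290 := by gcongr
      _ = 290 * Real.exp 289 := by ring
  have h5 : Real.exp (4 * (Real.log (Real.log ((M + 1 : ℕ) : ℝ)) + 4) +
      4 * (η * ((M + 1 : ℕ) : ℝ) ^ η * (Real.log ((M + 1 : ℕ) : ℝ) + 2))) ≤
      (Real.log z) ^ 4 * Real.exp (16 + 1160 * Real.exp 289) := by
    push_cast
    calc Real.exp (4 * (Real.log (Real.log ((M : ℝ) + 1)) + 4) +
          4 * (η * ((M : ℝ) + 1) ^ η * (Real.log ((M : ℝ) + 1) + 2)))
        ≤ Real.exp (4 * Real.log (Real.log z) + (16 + 1160 * Real.exp 289)) := by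
          rw [Real.exp_le_exp]; linarith
      _ = (Real.log z) ^ 4 * Real.exp (16 + 1160 * Real.exp 289) := by
          rw [Real.exp_add, show (4 : ℝ) * Real.log (Real.log z) =
            ((4 : ℕ) : ℝ) * Real.log (Real.log z) by norm_num, ← Real.log_pow,
            Real.exp_log (by positivity)]
  calc ((N.smoothNumbersUpTo (M + 1)).card : ℝ)
      ≤ (N : ℝ) ^ (1 - η) * Real.exp (4 * (Real.log (Real.log ((M + 1 : ℕ) : ℝ)) + 4) +
          4 * (η * ((M + 1 : ℕ) : ℝ) ^ η * (Real.log ((M + 1 : ℕ) : ℝ) + 2))) := h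
    _ ≤ (N / (Real.log z) ^ 6) * ((Real.log z) ^ 4 * Real.exp (16 + 1160 * Real.exp 289)) := by
          gcongr
    _ = N * Real.exp (16 + 1160 * Real.exp 289) / (Real.log z) ^ 2 := by
          field_simp

/-! ### The parameters `L = ⌊log z/(log log z)²⌋`, `K = 2L + 1`, `M = K^{24L}`, `η = 6 log₂ z/log z` -/

open Asymptotics in
/-- The growth facts used: eventually `log log z ≥ 96`, `(e^{48} + 2)(log log z)² ≤ log z` and
`log z ≥ 2 e^{C}`. [folklore] -/
private theorem eventually_growth :
    ∀ᶠ z : ℕ in atTop, 96 ≤ Real.log (Real.log z) ∧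
      (Real.exp 48 + 2) * (Real.log (Real.log z)) ^ 2 ≤ Real.log z ∧
      2 * Real.exp (16 + 1160 * Real.exp 289) ≤ Real.log z := by
  have hT : Tendsto (fun z : ℕ => Real.log z) atTop atTop :=
    Real.tendsto_log_atTop.comp tendsto_natCast_atTop_atTop
  have hT₂ : Tendsto (fun z : ℕ => Real.log (Real.log z)) atTop atTop :=
    Real.tendsto_log_atTop.comp hT
  have hε : (0 : ℝ) < 1 / (Real.exp 48 + 2) := by positivity
  have ho := (Real.isLittleO_pow_log_id_atTop (n := 2)).bound hε
  filter_upwards [hT₂.eventually_ge_atTop 96, hT.eventually ho,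
    hT.eventually_ge_atTop (2 * Real.exp (16 + 1160 * Real.exp 289)),
    hT.eventually_ge_atTop 1] with z h96 hb hC h1
  refine ⟨h96, ?_, hC⟩
  rw [Real.norm_eq_abs, Real.norm_eq_abs, id, abs_of_nonneg (by positivity),
    abs_of_nonneg (by linarith)] at hb
  have hpos : (0 : ℝ) < Real.exp 48 + 2 := by positivity
  calc (Real.exp 48 + 2) * Real.log (Real.log z) ^ 2
      ≤ (Real.exp 48 + 2) * (1 / (Real.exp 48 + 2) * Real.log z) := by gcongr
    _ = Real.log z := by field_simp

/-- Deterministic consequences for the parameters `L = ⌊ℓ/ℓ₂²⌋`, `K = 2L+1`: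
`L ≥ 1`, `log K ≥ 48`, `24 L log K ≤ ℓ/2` (so `log M ≤ ℓ/2`), `L ≤ ℓ/ℓ₂²`, `12 ℓ₂ ≤ ℓ`,
`(6ℓ₂/ℓ) · 24 L log K ≤ 288`. [folklore] -/
private theorem params {ℓ ℓ₂ : ℝ} {L : ℕ} (hℓ₂ : 96 ≤ ℓ₂) (hB : (Real.exp 48 + 2) * ℓ₂ ^ 2 ≤ ℓ)
    (hℓ₂def : ℓ₂ = Real.log ℓ) (hL : L = ⌊ℓ / ℓ₂ ^ 2⌋₊) :
    1 ≤ L ∧ (48 : ℝ) ≤ Real.log ((2 * L + 1 : ℕ) : ℝ) ∧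
      (24 * L : ℝ) * Real.log ((2 * L + 1 : ℕ) : ℝ) ≤ ℓ / 2 ∧
      (L : ℝ) ≤ ℓ / ℓ₂ ^ 2 ∧ 12 * ℓ₂ ≤ ℓ ∧
      (6 * ℓ₂ / ℓ) * ((24 * L : ℝ) * Real.log ((2 * L + 1 : ℕ) : ℝ)) ≤ 288 := by
  have hℓ₂0 : 0 < ℓ₂ := by linarith
  have hℓ₂sq : 96 * ℓ₂ ≤ ℓ₂ ^ 2 := by nlinarith
  have he48 : (48 : ℝ) + 1 ≤ Real.exp 48 := Real.add_one_le_exp 48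
  have hℓbig : 51 * (96 * ℓ₂) ≤ ℓ := by nlinarith
  have hℓ0 : 0 < ℓ := by linarith
  have hquot : Real.exp 48 + 2 ≤ ℓ / ℓ₂ ^ 2 := by
    rw [le_div_iff₀ (by positivity)]; exact hB
  have hLr : ℓ / ℓ₂ ^ 2 - 1 < L := by rw [hL]; exact Nat.sub_one_lt_floor _
  have hLle : (L : ℝ) ≤ ℓ / ℓ₂ ^ 2 := by rw [hL]; exact Nat.floor_le (by positivity)
  have hL48 : Real.exp 48 + 1 < L := by linarith
  have hL1r : (1 : ℝ) ≤ L := by linarith [Real.exp_pos 48]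
  have hL1 : 1 ≤ L := by exact_mod_cast hL1r
  have hKr : ((2 * L + 1 : ℕ) : ℝ) = 2 * L + 1 := by push_cast; ring
  have hK48 : (48 : ℝ) ≤ Real.log ((2 * L + 1 : ℕ) : ℝ) := by
    rw [hKr]
    have : Real.exp 48 ≤ 2 * (L : ℝ) + 1 := by linarith
    calc (48 : ℝ) = Real.log (Real.exp 48) := (Real.log_exp 48).symm
      _ ≤ Real.log (2 * L + 1) := Real.log_le_log (Real.exp_pos 48) this
  -- `log K ≤ log 3 + log L ≤ log 3 + log ℓ - 2 log ℓ₂ ≤ 2 ℓ₂`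
  have hlogK : Real.log ((2 * L + 1 : ℕ) : ℝ) ≤ 2 * ℓ₂ := by
    rw [hKr]
    have h3L : 2 * (L : ℝ) + 1 ≤ 3 * L := by linarith
    have hℓ₂1 : 1 ≤ ℓ₂ ^ 2 := by nlinarith
    have hLℓ : (L : ℝ) ≤ ℓ := hLle.trans (div_le_self hℓ0.le hℓ₂1)
    have hlog3 : Real.log 3 ≤ 2 := by
      have := Real.add_one_le_exp (2 : ℝ)
      have h9 : Real.log 3 ≤ Real.log (Real.exp 2) := Real.log_le_log (by norm_num) (by linarith)
      rwa [Real.log_exp] at h9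
    calc Real.log (2 * L + 1) ≤ Real.log (3 * ℓ) :=
          Real.log_le_log (by linarith) (by linarith)
      _ = Real.log 3 + Real.log ℓ := Real.log_mul (by norm_num) hℓ0.ne'
      _ ≤ 2 + ℓ₂ := by rw [← hℓ₂def]; linarith
      _ ≤ 2 * ℓ₂ := by linarith
  have hlogK0 : 0 ≤ Real.log ((2 * L + 1 : ℕ) : ℝ) := by linarith
  have hlogM : (24 * L : ℝ) * Real.log ((2 * L + 1 : ℕ) : ℝ) ≤ 48 * (ℓ / ℓ₂) := by
    calc (24 * L : ℝ) * Real.log ((2 * L + 1 : ℕ) : ℝ) ≤ 24 * (ℓ / ℓ₂ ^ 2) * (2 * ℓ₂) := by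
          gcongr
      _ = 48 * (ℓ / ℓ₂) := by field_simp; ring
  have hℓℓ₂ : 48 * (ℓ / ℓ₂) ≤ ℓ / 2 := by
    rw [mul_div_assoc', div_le_div_iff₀ hℓ₂0 (by norm_num)]; nlinarith
  refine ⟨hL1, hK48, hlogM.trans hℓℓ₂, hLle, by nlinarith, ?_⟩
  calc 6 * ℓ₂ / ℓ * ((24 * L : ℝ) * Real.log ((2 * L + 1 : ℕ) : ℝ))
      ≤ 6 * ℓ₂ / ℓ * (48 * (ℓ / ℓ₂)) := by gcongr
    _ = 288 := by field_simp; ring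

open Asymptotics in
/-- The prime number theorem (tree: `primeCounting_isEquivalent_holds`) as two-sided bounds.
[folklore] -/
private theorem eventually_abs_primeCounting_sub_le {κ : ℝ} (hκ : 0 < κ) :
    ∀ᶠ x : ℝ in atTop,
      |(Nat.primeCounting ⌊x⌋₊ : ℝ) - x / Real.log x| ≤ κ * (x / Real.log x) := by
  have h0 : (fun x : ℝ ↦ (Nat.primeCounting ⌊x⌋₊ : ℝ)) ~[atTop] fun x ↦ x / Real.log x :=
    Literature.NumberTheory.LFunctions.primeCounting_isEquivalent_holds
  filter_upwards [h0.isLittleO.bound hκ, eventually_ge_atTop (1 : ℝ)] with x hx hx1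
  have hx0 : 0 ≤ x := by linarith
  have hl0 : 0 ≤ Real.log x := Real.log_nonneg hx1
  have hnn : 0 ≤ x / Real.log x := div_nonneg hx0 hl0
  simpa [Real.norm_eq_abs, abs_div, abs_of_nonneg hnn, abs_of_nonneg hx0, abs_of_nonneg hl0]
    using hx

/-- Eventually `L(z) = ⌊log z/(log log z)²⌋ ≥ 1`. [folklore] -/
private theorem eventually_one_le_L :
    ∀ᶠ z : ℕ in atTop, 1 ≤ ⌊Real.log z / (Real.log (Real.log z)) ^ 2⌋₊ := by
  filter_upwards [eventually_growth] with z hg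
  exact (params hg.1 hg.2.1 rfl rfl).1

/-- PNT consequences along the Erdős parameters: `π(Lz) ≤ 1.1 L z/log z`, `π(z) ≥ 0.9 z/log z`,
`π(⌊z/2⌋) ≤ 0.605 z/log z`. [folklore] -/
private theorem eventually_pnt_bounds_erdos :
    ∀ᶠ z : ℕ in atTop,
      (Nat.primeCounting (⌊Real.log z / (Real.log (Real.log z)) ^ 2⌋₊ * z) : ℝ) ≤
          11 / 10 * (((⌊Real.log z / (Real.log (Real.log z)) ^ 2⌋₊ : ℕ) : ℝ) * (z / Real.log z)) ∧
      9 / 10 * (z / Real.log z) ≤ (Nat.primeCounting z : ℝ) ∧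
      (Nat.primeCounting (z / 2) : ℝ) ≤ 121 / 200 * (z / Real.log z) := by
  have hκ : (0 : ℝ) < 1 / 10 := by norm_num
  have hcast : Tendsto (fun z : ℕ => (z : ℝ)) atTop atTop := tendsto_natCast_atTop_atTop
  set f : ℕ → ℕ := fun z => ⌊Real.log z / (Real.log (Real.log z)) ^ 2⌋₊ * z with hf
  have hfge : ∀ᶠ z : ℕ in atTop, z ≤ f z := by
    filter_upwards [eventually_one_le_L] with z hz
    exact Nat.le_mul_of_pos_left z hz
  have hft : Tendsto f atTop atTop := tendsto_atTop_mono' atTop hfge tendsto_id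
  have h1 := (hcast.comp hft).eventually (eventually_abs_primeCounting_sub_le hκ)
  have h2 := hcast.eventually (eventually_abs_primeCounting_sub_le hκ)
  have h3 := (hcast.atTop_div_const (by norm_num : (0 : ℝ) < 2)).eventually
    (eventually_abs_primeCounting_sub_le hκ)
  filter_upwards [h1, h2, h3, eventually_ge_atTop 2048, hfge] with z hz1 hz2 hz3 hz hzf
  have hz' : (2048 : ℝ) ≤ z := by exact_mod_cast hz
  have hzpos : (0 : ℝ) < z := by linarith
  have hlog2 : Real.log 2048 = 11 * Real.log 2 := by
    rw [show (2048 : ℝ) = 2 ^ 11 by norm_num, Real.log_pow]; norm_num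
  have hlogz : 11 * Real.log 2 ≤ Real.log z := hlog2 ▸ Real.log_le_log (by norm_num) hz'
  have hlog2pos : 0 < Real.log 2 := Real.log_pos (by norm_num)
  have hlogzpos : 0 < Real.log z := by linarith
  have hW0 : 0 ≤ (z : ℝ) / Real.log z := by positivity
  refine ⟨?_, ?_, ?_⟩
  · have hfl : ⌊((f z : ℕ) : ℝ)⌋₊ = f z := Nat.floor_natCast _
    simp only [Function.comp_apply] at hz1
    rw [hfl] at hz1
    have hfz : ((f z : ℕ) : ℝ) = ((⌊Real.log z / (Real.log (Real.log z)) ^ 2⌋₊ : ℕ) : ℝ) * z := by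
      rw [hf]; push_cast; ring
    have hfz' : (z : ℝ) ≤ ((f z : ℕ) : ℝ) := by exact_mod_cast hzf
    have hlogf : Real.log z ≤ Real.log ((f z : ℕ) : ℝ) := Real.log_le_log hzpos hfz'
    have hL0 : (0 : ℝ) ≤ ((⌊Real.log z / (Real.log (Real.log z)) ^ 2⌋₊ : ℕ) : ℝ) := by positivity
    have hq : ((f z : ℕ) : ℝ) / Real.log ((f z : ℕ) : ℝ) ≤
        ((⌊Real.log z / (Real.log (Real.log z)) ^ 2⌋₊ : ℕ) : ℝ) * (z / Real.log z) :=
      calc ((f z : ℕ) : ℝ) / Real.log ((f z : ℕ) : ℝ) ≤ ((f z : ℕ) : ℝ) / Real.log z :=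
            div_le_div_of_nonneg_left (by positivity) hlogzpos hlogf
        _ = ((⌊Real.log z / (Real.log (Real.log z)) ^ 2⌋₊ : ℕ) : ℝ) * (z / Real.log z) := by
            rw [hfz]; ring
    have := (abs_le.1 hz1).2
    have hf0 : 0 ≤ ((f z : ℕ) : ℝ) / Real.log ((f z : ℕ) : ℝ) :=
      div_nonneg (by positivity) (hlogzpos.le.trans hlogf)
    change (Nat.primeCounting (f z) : ℝ) ≤ _
    nlinarith [hq, hL0]
  · have hfl : ⌊(z : ℝ)⌋₊ = z := Nat.floor_natCast z
    rw [hfl] at hz2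
    have := (abs_le.1 hz2).1
    linarith
  · have hfl : ⌊(z : ℝ) / 2⌋₊ = z / 2 := Nat.floor_div_eq_div z 2
    rw [hfl] at hz3
    have := (abs_le.1 hz3).2
    have hlogh : Real.log ((z : ℝ) / 2) = Real.log z - Real.log 2 := by
      rw [Real.log_div hzpos.ne' (by norm_num)]
    have hlogh' : 10 / 11 * Real.log z ≤ Real.log ((z : ℝ) / 2) := by rw [hlogh]; linarith
    have hloghpos : 0 < Real.log ((z : ℝ) / 2) := by linarith
    have hq : (z : ℝ) / 2 / Real.log ((z : ℝ) / 2) ≤ 11 / 20 * (z / Real.log z) := by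
      rw [div_le_iff₀ hloghpos]
      calc (z : ℝ) / 2 = 11 / 20 * (z / Real.log z) * (10 / 11 * Real.log z) := by
            field_simp; ring
        _ ≤ 11 / 20 * (z / Real.log z) * Real.log ((z : ℝ) / 2) := by gcongr
    linarith

/-! ### Erdős's theorem -/

/-- The cover for one `z`, all parameters explicit (`ℓ = log z`, `ℓ₂ = log ℓ`, `L = ⌊ℓ/ℓ₂²⌋`,
`K = 2L+1`, `M = K^{24L}`, `N = Lz`), given the growth facts and the three PNT bounds. [folklore] -/
private theorem cover_of_params {z L K M N : ℕ} {ℓ ℓ₂ : ℝ} (hz3 : 3 ≤ z) (hℓ : ℓ = Real.log z)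
    (hℓ₂ : ℓ₂ = Real.log ℓ) (hL : L = ⌊ℓ / ℓ₂ ^ 2⌋₊) (hK : K = 2 * L + 1) (hM : M = K ^ (24 * L))
    (hN : N = L * z) (h96 : 96 ≤ ℓ₂) (hB : (Real.exp 48 + 2) * ℓ₂ ^ 2 ≤ ℓ)
    (hC : 2 * Real.exp (16 + 1160 * Real.exp 289) ≤ ℓ)
    (hπN : (Nat.primeCounting N : ℝ) ≤ 11 / 10 * (L * (z / ℓ)))
    (hπz : 9 / 10 * (z / ℓ) ≤ (Nat.primeCounting z : ℝ))
    (hπQ : (Nat.primeCounting (z / 2) : ℝ) ≤ 121 / 200 * (z / ℓ)) :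
    ResidueClassesCover z N := by
  obtain ⟨hL1, hK48, hlogM, hLle, h12, h288⟩ := params h96 hB hℓ₂ hL
  rw [← hK] at hK48 hlogM h288
  obtain ⟨C, hCdef⟩ : ∃ C : ℝ, C = Real.exp (16 + 1160 * Real.exp 289) := ⟨_, rfl⟩
  rw [← hCdef] at hC
  have hCpos : 0 < C := by rw [hCdef]; positivity
  -- positivity
  have hzr : (3 : ℝ) ≤ z := by exact_mod_cast hz3
  have hz0 : (0 : ℝ) < z := by linarith
  have hℓ1 : 1 < ℓ := by
    rw [hℓ, ← Real.exp_lt_exp, Real.exp_log hz0]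
    have := Real.exp_one_lt_d9; linarith
  have hℓ0 : 0 < ℓ := by linarith
  have hℓ₂0 : 0 < ℓ₂ := by linarith
  have hexpℓ : Real.exp ℓ = z := by rw [hℓ, Real.exp_log hz0]
  have hexpℓ₂ : Real.exp ℓ₂ = ℓ := by rw [hℓ₂, Real.exp_log hℓ0]
  have hLr0 : (0 : ℝ) < L := by exact_mod_cast hL1
  -- `K`, `M`
  have hK2 : 2 ≤ K := by omega
  have hlogK0 : 0 < Real.log (K : ℝ) := by linarith
  have hMr : (M : ℝ) = (K : ℝ) ^ (24 * L) := by rw [hM]; push_cast; ring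
  have hlogMeq : Real.log M = (24 * L : ℝ) * Real.log K := by
    rw [hMr, Real.log_pow]; push_cast; ring
  have hKM : K ≤ M := by rw [hM]; exact Nat.le_self_pow (by omega) K
  have hM1 : 1 ≤ M := le_trans (by omega) hKM
  have hM0r : (0 : ℝ) < M := by exact_mod_cast (show 0 < M by omega)
  have hlogMle : Real.log M ≤ ℓ / 2 := by rw [hlogMeq]; exact hlogM
  have hMle : (M : ℝ) ≤ z / (20 * ℓ) := by
    have h20 := Real.log_le_sub_one_of_pos (show (0 : ℝ) < 20 by norm_num)
    have h20' : Real.exp (Real.log 20) = 20 := Real.exp_log (by norm_num)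
    have h1 : Real.log M ≤ ℓ - (Real.log 20 + ℓ₂) := by linarith
    calc (M : ℝ) = Real.exp (Real.log M) := (Real.exp_log hM0r).symm
      _ ≤ Real.exp (ℓ - (Real.log 20 + ℓ₂)) := Real.exp_le_exp.2 h1
      _ = z / (20 * ℓ) := by rw [Real.exp_sub, Real.exp_add, h20', hexpℓ, hexpℓ₂]
  have hMz20 : (M : ℝ) ≤ z / 20 := by
    refine hMle.trans (div_le_div_of_nonneg_left hz0.le (by norm_num) ?_)
    linarith
  have hMQ : M ≤ z / 2 := by
    rw [Nat.le_div_iff_mul_le (by norm_num)]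
    have : (M : ℝ) * 2 ≤ z := by linarith
    exact_mod_cast this
  have hMz : M + 1 ≤ z := by
    have : (M : ℝ) + 1 ≤ z := by linarith
    exact_mod_cast this
  -- `η`
  obtain ⟨η, hη⟩ : ∃ η : ℝ, η = 6 * ℓ₂ / ℓ := ⟨_, rfl⟩
  have hη0 : 0 < η := by rw [hη]; positivity
  have hηhalf : η ≤ 1 / 2 := by rw [hη, div_le_iff₀ hℓ0]; linarith
  have hηdef : η * Real.log z = 6 * Real.log (Real.log z) := by
    rw [hη, ← hℓ, ← hℓ₂]; field_simp
  have hηM : η * Real.log ((M : ℝ) + 1) ≤ 289 := by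
    have hlog2 : Real.log 2 ≤ 1 := by
      have := Real.log_two_lt_d9; norm_num at this; linarith
    have hlogM1 : Real.log ((M : ℝ) + 1) ≤ Real.log M + 1 := by
      have hM1r : (1 : ℝ) ≤ M := by exact_mod_cast hM1
      calc Real.log ((M : ℝ) + 1) ≤ Real.log (2 * M) :=
            Real.log_le_log (by linarith) (by linarith)
        _ = Real.log 2 + Real.log M := Real.log_mul (by norm_num) hM0r.ne'
        _ ≤ Real.log M + 1 := by linarith
    have h1 : η * Real.log M ≤ 288 := by rw [hlogMeq, hη]; exact h288
    have h2 := mul_le_mul_of_nonneg_left hlogM1 hη0.le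
    linarith
  -- the smooth-number bound and the shape conditions
  have hzN : z ≤ N := by rw [hN]; exact Nat.le_mul_of_pos_left z hL1
  have hΨ := card_smooth_le hz3 hzN hM1 hMz hη0 hηhalf hηdef hηM
  rw [← hℓ, ← hCdef] at hΨ
  have hNQK : N < (z / 2 + 1) * (K + 1) := by
    have h2Q : z < 2 * (z / 2 + 1) := by omega
    calc N = L * z := hN
      _ < L * (2 * (z / 2 + 1)) := Nat.mul_lt_mul_of_pos_left h2Q hL1
      _ ≤ (z / 2 + 1) * (K + 1) := by rw [hK]; nlinarith
  -- Mertens: the greedy product is `≤ 1/(8L)`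
  have hprod : ∏ p ∈ (Ioc K M).filter Nat.Prime, (1 - 1 / (p : ℝ)) ≤ 1 / (8 * L) := by
    have := prod_one_sub_inv_Ioc_le hK2 hK48 hKM
    rw [hlogMeq] at this
    refine this.trans (le_of_eq ?_)
    field_simp
    ring
  have hprod0 : 0 ≤ ∏ p ∈ (Ioc K M).filter Nat.Prime, (1 - 1 / (p : ℝ)) := by
    refine Finset.prod_nonneg fun q hq => ?_
    have hq1 : (1 : ℝ) ≤ q := by exact_mod_cast (mem_filter.1 hq).2.one_le
    rw [sub_nonneg, div_le_one (by linarith)]; exact hq1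
  -- the count
  have hNr : (N : ℝ) = L * z := by rw [hN]; push_cast; ring
  obtain ⟨W, hW⟩ : ∃ W : ℝ, W = (z : ℝ) / ℓ := ⟨_, rfl⟩
  rw [← hW] at hπN hπz hπQ
  have hW0 : 0 ≤ W := by rw [hW]; positivity
  have hA : (N : ℝ) * C / ℓ ^ 2 * (1 / (8 * L)) ≤ 1 / 10 * W := by
    have hC16 : C / (8 * ℓ) ≤ 1 / 16 := by
      rw [div_le_iff₀ (by positivity)]; linarith
    have hWC := mul_le_mul_of_nonneg_left hC16 hW0
    calc (N : ℝ) * C / ℓ ^ 2 * (1 / (8 * L)) = W * (C / (8 * ℓ)) := by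
          rw [hNr, hW]; field_simp
      _ ≤ W * (1 / 16) := hWC
      _ ≤ 1 / 10 * W := by linarith only [hW0]
  have hB' : (Nat.primeCounting N : ℝ) * (1 / (8 * L)) ≤ 11 / 80 * W := by
    have h8 : (0 : ℝ) ≤ 1 / (8 * L) := by positivity
    calc (Nat.primeCounting N : ℝ) * (1 / (8 * L)) ≤ 11 / 10 * (L * W) * (1 / (8 * L)) :=
          mul_le_mul_of_nonneg_right hπN h8
      _ = 11 / 80 * W := by field_simp; ring
  have hM' : (M : ℝ) ≤ 1 / 20 * W := by
    rw [hW, show 1 / 20 * ((z : ℝ) / ℓ) = z / (20 * ℓ) by ring]; exact hMle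
  have hcount : (((N.smoothNumbersUpTo (M + 1)).card : ℝ) + Nat.primeCounting N) *
      (∏ p ∈ (Ioc K M).filter Nat.Prime, (1 - 1 / (p : ℝ))) + M
      ≤ (Nat.primeCounting z : ℝ) - Nat.primeCounting (z / 2) := by
    have hS0 : 0 ≤ ((N.smoothNumbersUpTo (M + 1)).card : ℝ) + Nat.primeCounting N := by
      positivity
    have h1 := mul_le_mul_of_nonneg_left hprod hS0
    have h2 : (((N.smoothNumbersUpTo (M + 1)).card : ℝ) + Nat.primeCounting N) * (1 / (8 * L))
        ≤ ((N : ℝ) * C / ℓ ^ 2 + Nat.primeCounting N) * (1 / (8 * L)) :=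
      mul_le_mul_of_nonneg_right (by linarith only [hΨ]) (by positivity)
    have h3 : ((N : ℝ) * C / ℓ ^ 2 + Nat.primeCounting N) * (1 / (8 * L)) =
        (N : ℝ) * C / ℓ ^ 2 * (1 / (8 * L)) + Nat.primeCounting N * (1 / (8 * L)) := by ring
    linarith only [h1, h2, h3, hA, hB', hM', hπz, hπQ, hW0]
  exact residueClassesCover_of_count hKM hMQ hNQK hcount

/-- **`Y(z) ≥ L(z) · z` with `L(z) = ⌊log z/(log log z)²⌋`** for all large `z` (MV Lemma 7.13 run
with `L` depending on `z`, as in the proof of Theorem 7.15; Erdős 1935).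
[cite: MontgomeryVaughan2007, Theorem 7.15 (proof)] [cite: Erdos1935, Theorem] -/
theorem residueClassesCover_erdos :
    ∀ᶠ z : ℕ in atTop,
      ResidueClassesCover z (⌊Real.log z / (Real.log (Real.log z)) ^ 2⌋₊ * z) := by
  filter_upwards [eventually_growth, eventually_pnt_bounds_erdos, eventually_ge_atTop 3]
    with z hg hpnt hz3
  obtain ⟨h96, hB, hC⟩ := hg
  obtain ⟨hπN, hπz, hπQ⟩ := hpnt
  exact cover_of_params (L := ⌊Real.log z / (Real.log (Real.log z)) ^ 2⌋₊)
    (K := 2 * ⌊Real.log z / (Real.log (Real.log z)) ^ 2⌋₊ + 1) hz3 rfl rfl rfl rfl rfl rfl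
    h96 hB hC hπN hπz hπQ

/-- The gap for one `X`, all parameters explicit. [folklore] -/
private theorem gap_of_params {X ℓ ℓ₂ t s : ℝ} {z L : ℕ} (hz : z = ⌊Real.log X / 3⌋₊)
    (hℓ : ℓ = Real.log z) (hℓ₂ : ℓ₂ = Real.log ℓ) (hL : L = ⌊ℓ / ℓ₂ ^ 2⌋₊)
    (ht : t = Real.log (Real.log X)) (hs : s = Real.log t)
    (hcovX : ResidueClassesCover z (L * z)) (hz3 : 3 ≤ z) (h96 : 96 ≤ ℓ₂)
    (hB : (Real.exp 48 + 2) * ℓ₂ ^ 2 ≤ ℓ) (hoT : Real.log t ^ 2 ≤ 1 / 4 * t)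
    (hoX : Real.log X ^ 2 ≤ 1 / 8 * X) (hlinX : Real.log X ≤ 1 / 8 * X) (hT3 : 3 ≤ t)
    (hX16 : 16 ≤ X) (hX12 : Real.exp 12 ≤ X) :
    HasPrimeGap X (1 / 16 * (Real.log X * Real.log^[2] X / Real.log^[3] X ^ 2)) := by
  obtain ⟨hL1, -, -, hLle, -, -⟩ := params h96 hB hℓ₂ hL
  have hXpos : 0 < X := by linarith
  have hlogX12 : 12 ≤ Real.log X := by
    have := Real.log_le_log (Real.exp_pos 12) hX12
    rwa [Real.log_exp] at this
  have hlogXpos : 0 < Real.log X := by linarith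
  have ht1 : 1 < t := by linarith
  have ht0 : 0 < t := by linarith
  have hs0 : 0 < s := by rw [hs]; exact Real.log_pos ht1
  have hzr : (3 : ℝ) ≤ z := by exact_mod_cast hz3
  have hz0 : (0 : ℝ) < z := by linarith
  have hzle : (z : ℝ) ≤ Real.log X / 3 := by rw [hz]; exact Nat.floor_le (by positivity)
  have hzge : Real.log X / 3 - 1 < z := by rw [hz]; exact Nat.sub_one_lt_floor _
  have hz4 : Real.log X / 4 ≤ z := by linarith
  -- `ℓ = log z ≥ t − log 4 ≥ t/2`, `ℓ ≤ t`, `0 < ℓ₂ ≤ s`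
  have hlog4 : Real.log 4 ≤ 3 / 2 := by
    rw [show (4 : ℝ) = 2 ^ 2 by norm_num, Real.log_pow]
    have := Real.log_two_lt_d9; norm_num at this ⊢; linarith
  have hℓge : t / 2 ≤ ℓ := by
    have h1 : Real.log (Real.log X / 4) ≤ ℓ := by rw [hℓ]; exact Real.log_le_log (by positivity) hz4
    rw [Real.log_div hlogXpos.ne' (by norm_num), ← ht] at h1
    linarith
  have hℓle : ℓ ≤ t := by
    rw [hℓ, ht]
    exact Real.log_le_log hz0 (by linarith)
  have hℓ1 : 1 < ℓ := by linarith
  have hℓ0 : 0 < ℓ := by linarith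
  have hℓ₂0 : 0 < ℓ₂ := by rw [hℓ₂]; exact Real.log_pos hℓ1
  have hℓ₂le : ℓ₂ ≤ s := by rw [hℓ₂, hs]; exact Real.log_le_log hℓ0 hℓle
  -- `4 s² ≤ t`
  have hst : 4 * s ^ 2 ≤ t := by rw [hs]; linarith
  -- `L ≥ t/(4 s²)`
  have hLge : t / (4 * s ^ 2) ≤ (L : ℝ) := by
    have hLr : ℓ / ℓ₂ ^ 2 - 1 < L := by rw [hL]; exact Nat.sub_one_lt_floor _
    have h1 : t / 2 / s ^ 2 ≤ ℓ / ℓ₂ ^ 2 := by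
      calc t / 2 / s ^ 2 ≤ ℓ / s ^ 2 := by gcongr
        _ ≤ ℓ / ℓ₂ ^ 2 := by
            apply div_le_div_of_nonneg_left hℓ0.le (by positivity)
            exact pow_le_pow_left₀ hℓ₂0.le hℓ₂le 2
    have h2 : 1 ≤ t / (4 * s ^ 2) := by rw [le_div_iff₀ (by positivity)]; linarith
    have h3 : t / 2 / s ^ 2 = 2 * (t / (4 * s ^ 2)) := by field_simp; ring
    linarith
  -- the gap supplied by the cover
  have hLz1 : 1 ≤ L * z := le_trans (by omega : 1 ≤ z) (Nat.le_mul_of_pos_left z hL1)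
  have hgap := hasPrimeGap_of_cover hcovX hLz1
  refine hgap.mono ?_ ?_
  · -- `2 (z + P(z) + L z) ≤ X`
    have hprim : ((primorial z : ℕ) : ℝ) ≤ Real.sqrt X := by
      have h4 : ((primorial z : ℕ) : ℝ) ≤ (4 : ℝ) ^ (z : ℝ) := by
        rw [Real.rpow_natCast]; exact_mod_cast primorial_le_four_pow z
      refine h4.trans ?_
      rw [Real.sqrt_eq_rpow, Real.rpow_def_of_pos (by norm_num : (0 : ℝ) < 4),
        Real.rpow_def_of_pos hXpos, Real.exp_le_exp]
      calc Real.log 4 * (z : ℝ) ≤ 3 / 2 * (Real.log X / 3) := by gcongr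
        _ = Real.log X * (1 / 2) := by ring
    have hsqrt : Real.sqrt X ≤ X / 4 := by
      have h16 : Real.sqrt 16 = 4 := by
        rw [show (16 : ℝ) = 4 ^ 2 by norm_num, Real.sqrt_sq (by norm_num)]
      have h4 : 4 ≤ Real.sqrt X := h16 ▸ Real.sqrt_le_sqrt hX16
      have h5 := Real.mul_self_sqrt hXpos.le
      have h6 := mul_le_mul_of_nonneg_right h4 (Real.sqrt_nonneg X)
      linarith only [h5, h6]
    have hℓ₂1 : 1 ≤ ℓ₂ ^ 2 := by nlinarith only [h96]
    have hLℓ : (L : ℝ) ≤ ℓ := hLle.trans (div_le_self hℓ0.le hℓ₂1)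
    have hLt : (L : ℝ) ≤ Real.log X := hLℓ.trans (hℓle.trans (by
      rw [ht]; exact (Real.log_le_sub_one_of_pos hlogXpos).trans (by linarith)))
    have hN : (L : ℝ) * z ≤ Real.log X ^ 2 :=
      calc (L : ℝ) * z ≤ Real.log X * (Real.log X / 3) := mul_le_mul hLt hzle hz0.le hlogXpos.le
        _ ≤ Real.log X ^ 2 := by
            rw [sq]; exact mul_le_mul_of_nonneg_left (by linarith only [hlogXpos]) hlogXpos.le
    have hzX : (z : ℝ) ≤ 1 / 8 * X := by linarith
    push_cast
    linarith only [hzX, hprim, hsqrt, hN, hoX, hlinX]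
  · -- `(1/16) log X log₂ X/(log₃ X)² ≤ L z + 1`
    have i2 : Real.log^[2] X = t := by
      rw [ht]; simp [Function.iterate_succ_apply']
    have i3 : Real.log^[3] X = s := by
      rw [hs, ht]; simp [Function.iterate_succ_apply']
    rw [i2, i3]
    push_cast
    have h1 : 1 / 16 * (Real.log X * t / s ^ 2) = t / (4 * s ^ 2) * (Real.log X / 4) := by
      field_simp; ring
    rw [h1]
    have hLz : t / (4 * s ^ 2) * (Real.log X / 4) ≤ (L : ℝ) * z :=
      mul_le_mul hLge hz4 (by positivity) (by positivity)
    linarith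

open Asymptotics in
/-- **Erdős 1935 (the form `G(X) ≥ c · log X · log₂ X/(log₃ X)²`)** — PROVED, with `c = 1/16`:
for all large `X` there are consecutive primes `p_n < p_{n+1} ≤ X` with
`p_{n+1} − p_n ≥ (1/16) · log X · log log X / (log log log X)²`. This discharges the named fact
`Erdos1935_largeGaps` (hence, by the proved chain of `LargeGapsBetweenPrimes.lean`, also
`Westzynthius1931`). [cite: Erdos1935, Theorem] [cite: MontgomeryVaughan2007, Theorem 7.15 (proof)] -/
theorem erdos1935_largeGaps_holds : Erdos1935_largeGaps := by
  refine ⟨1 / 16, by norm_num, ?_⟩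
  have hz : Tendsto (fun X : ℝ => ⌊Real.log X / 3⌋₊) atTop atTop :=
    tendsto_nat_floor_atTop.comp (Real.tendsto_log_atTop.atTop_div_const (by norm_num))
  have hT₂ : Tendsto (fun X : ℝ => Real.log (Real.log X)) atTop atTop :=
    Real.tendsto_log_atTop.comp Real.tendsto_log_atTop
  have ho := (Real.isLittleO_pow_log_id_atTop (n := 2)).bound (show (0 : ℝ) < 1 / 4 by norm_num)
  have hoX := (Real.isLittleO_pow_log_id_atTop (n := 2)).bound (show (0 : ℝ) < 1 / 8 by norm_num)
  have hlin := Real.isLittleO_log_id_atTop.bound (show (0 : ℝ) < 1 / 8 by norm_num)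
  filter_upwards [hz.eventually residueClassesCover_erdos, hz.eventually (eventually_ge_atTop 3),
    hz.eventually eventually_growth, hT₂.eventually ho, hoX, hlin,
    hT₂.eventually_ge_atTop 3, eventually_ge_atTop (16 : ℝ), eventually_ge_atTop (Real.exp 12)]
    with X hcovX hz3 hgz hoT hoX' hlinX hT3 hX16 hX12
  obtain ⟨h96, hB, -⟩ := hgz
  have hXpos : 0 < X := by linarith
  have hlogXpos : 0 < Real.log X := Real.log_pos (by linarith)
  have ht0 : 0 < Real.log (Real.log X) := by linarith
  rw [Real.norm_eq_abs, Real.norm_eq_abs, id, abs_of_nonneg (by positivity),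
    abs_of_nonneg ht0.le] at hoT
  rw [Real.norm_eq_abs, Real.norm_eq_abs, id, abs_of_nonneg (by positivity),
    abs_of_pos hXpos] at hoX'
  rw [Real.norm_eq_abs, Real.norm_eq_abs, id, abs_of_pos hlogXpos, abs_of_pos hXpos] at hlinX
  exact gap_of_params rfl rfl rfl rfl rfl rfl hcovX hz3 h96 hB hoT hoX' hlinX hT3 hX16 hX12

/-- `Erdos1935_largeGaps` — `_holds` alias of `erdos1935_largeGaps_holds` above under the fact's exact name (appended
2026-08-28, D-0026 bookkeeping: the proof term is the existing theorem of this file; no statement,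
definition or attribute is edited; no new named fact; the ledger's debt table listed the fact
unproved). [cite: MontgomeryVaughan2007, Theorem 7.15 (proof)] -/
theorem _root_.Literature.NumberTheory.Sieve.Erdos1935_largeGaps_holds : Erdos1935_largeGaps :=
  _root_.Literature.NumberTheory.Sieve.ErdosRankin.erdos1935_largeGaps_holds

end ErdosRankin

/-- Re-export: **Erdős's theorem** `∃ c > 0, ∀ᶠ X, G(X) ≥ c log X log₂ X/(log₃ X)²`
(named fact `Erdos1935_largeGaps`) holds. [cite: Erdos1935, Theorem] -/
theorem erdos1935_largeGaps_holds : Erdos1935_largeGaps := ErdosRankin.erdos1935_largeGaps_holds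


end Literature.NumberTheory.Sieve
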